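import Mathlib
import HarnessLib
import Summits.HubbardSuperconductivity.HubbardSuperconductivity.Theorems.KLProgrammeKLRegimeSectorMultiplierWtBound
import Summits.HubbardSuperconductivity.HubbardSuperconductivity.Theorems.KLProgrammeKLRegimeEngineAnisoTorusSumWtFlow
import Summits.HubbardSuperconductivity.HubbardSuperconductivity.Theorems.KLProgrammeH10TwoPointLimitOverlapKernelCharSum
import Summits.HubbardSuperconductivity.HubbardSuperconductivity.Theorems.KLProgrammeKLRegimeEngineV8E5PointAugmentOverlapPlainFat

/-!
# Route `KLProgramme` — ENGINE child gen 8 (stmt-HubbardSuperconductivity-20437 `KLRegimeEngineV17F2`), SKELETON v2 class #3, (RA-U) SUPPLIER part 4,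
# input 3, located item «(RA-U)-SMALL-N-ROWS»: the PLAIN overlap rows of ONE thin family against the trivial fat family, `E(klAnisoFamily J′)·S(1)`,
# at the flow frame `K_n`, any level `J′ ≤ n` — from p3's single-multiplier character-sum bound `charSumWt_klAniso_le_uniform`
# (cell gate-hubbard-kl, seat p5 g14; memo HOME/prover-p5/g14/ITEM3-OVERLAP.md §3; also the shape of E1's block-0 first slice, blueprint g8 §1 (β))

Each entry of `E(F_{J′})·S(1)` is `(βL²)⁻¹Σ_k F_{J′,ω}(k)e^{ik(x″−x′)}`, so its row/column sums at fixed labels are `(βL²)⁻¹·Σ_z‖Σ_q χχ•F_{J′,ω}(k q)‖`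
(p4's `rowSum_/colSum_overlapKernel_eq` with `F := trivialMultiplier`).  p3 g10's `charSumWt_klAniso_le_uniform` (…SectorMultiplierWtBound, the `2M`-grid /
pair convention) bounds the WEIGHTED sum `Σ_z (1 + s₀|j̃| + s₁|z̃|₁)·‖…‖ ≤ √(a·b/e₀)·M·L²` for ONE sector function on any admissible frame, uniformly; the weight
is `≥ 1`.  The regime plumbing is p3's `anisoTorusSumWt_flow_rates` (…AnisoTorusSumWtFlow: p4's keying `B = bandBounds (−6/5) (−1/10)`, `A = κ₀/4`,
`regime_scale_thresholds₃`, the flow frame's order-three datum `‖D³e_{K_n}‖ ≤ Gfr₃U²4ⁿ/3` from the history) run at LEVEL `J′ ≤ n` on the frame `K_n`: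
the only level-sensitive input is the order-three datum `A₃·Λ_{J′}² ≤ 1/3072`, which holds under the window **`4ⁿ·U ≤ 16^{J′}`** (`Gfr₃U ≤ 1`) —
automatic for `J′ = n` (p3's case) and for the supplier's small steps `n ≤ 4` (`U ≤ 1/960`).

* **`charSum_klAniso_single_klEng_flow`** — ONE absolute `T > 0`: under p3's binders (`R.WF2`, `0 < cc ≤ klEngC₃6`, `μ ∈ klWindowC`,
  `0 < U ≤ min klEngU₀3 (1/(Gfr₃+1))`, `klBetaMin ≤ β ≤ e^{cc/U²}`, `klEngL₃ ≤ L`, `klEngM₃ ≤ M`, `1 ≤ n ≤ n_β+1`, `HistP klPredsV17F2 … 0 n`, `FrameOK … K_n`),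
  for every `J′ ≤ n` with `4ⁿ·U ≤ 16^{J′}` and every sector `ω` of level `J′`: `Σ_z ‖Σ_q χ_{q₁}(z₁)χ_{q₂}(z₂) • F_{J′,ω}(k q)‖ ≤ T·M·L²`;
* **`overlapRows_klAniso_trivial_klEng_flow`** — hence `hrow′ ≤ T·M/β` and `hcol′ ≤ sectorCount J′ · T·M/β` for `E(klAnisoFamily … K_n klE0 J′)·S(trivialMultiplier)`;
* **`overlapRows_klAniso_trivial_klEng_small`** — the supplier's small steps `n ≤ 4` (window discharged): the same two bounds, and, through
  `overlapRows_pointAugment_klAniso_trivial` (…E5PointAugmentOverlapPlainFat), on the point-augmented output family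
  `E(pointAugment (klAnisoFamily J′) e)·S(1)`: `cr⁺ = (T + 2)·M/β`, `cc⁺ = (sectorCount J′ · T + 2q)·M/β` — closing «(RA-U)-SMALL-N-ROWS».

Everything is proved; no definitions; no named facts; nothing about the model's sizes beyond the cited (L2) data is asserted; nothing asserts
superconductivity. [cite: BenfattoGiulianiMastropietro2006, Lemma 2.2 (2.52)–(2.55), §2.6 (2.81), §2.7 (2.71a)]
-/

noncomputable section

namespace Summit.HubbardSuperconductivity.HubbardSuperconductivity.Theorems.KLRegimeSplit

set_option linter.dupNamespace false -- summit = problem name (single-conjunct summit), D-0017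

open Real Finset Literature.MathematicalPhysics.QuantumLattice Literature.MathematicalPhysics.QuantumLattice.BandSectorCounting
open Literature.MathematicalPhysics.QuantumLattice.FermiRG Literature.Probability.LatticeModels Literature.Analysis.SpecialFunctions Matrix
open Summit.HubbardSuperconductivity.HubbardSuperconductivity.Theorems.DispersionFlow
open Summit.HubbardSuperconductivity.HubbardSuperconductivity.Theorems.KLProgrammeLegKernels
open Summit.HubbardSuperconductivity.HubbardSuperconductivity.Theorems.PerturbedFermiCurve
open Summit.HubbardSuperconductivity.HubbardSuperconductivity.Theorems.KLRegimeWick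
open Summit.HubbardSuperconductivity.HubbardSuperconductivity.Theorems.TorusFourierL2

/-! ## §1 The single-multiplier character sum at the flow frame, any level `J′ ≤ n` -/

set_option maxHeartbeats 1600000 in -- long regime bookkeeping with large explicit constants (verbatim the pattern of p3's `anisoTorusSumWt_flow_rates`)
/-- **The `ℓ¹` character sum of ONE thin multiplier of level `J′ ≤ n` at the flow frame `K_n`, KL regime, ONE absolute constant** (see the module
docstring; window `4ⁿ·U ≤ 16^{J′}`). [cite: BenfattoGiulianiMastropietro2006, Lemma 2.2 (2.52)–(2.55), §2.6 (2.81)] -/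
theorem charSum_klAniso_single_klEng_flow :
    ∃ T : ℝ, 0 < T ∧
      ∀ (G : GeoConsts) (P : SplitConsts) (R : RenConsts) (Q : EngConsts) (cc : ℝ), R.WF2 → 0 < cc → cc ≤ EngineV8.klEngC₃6 P R →
      ∀ μ ∈ klWindowC, ∀ U : ℝ, 0 < U → U ≤ min (EngineV8.klEngU₀3 P R cc) (1 / (R.Gfr 3 + 1)) →
      ∀ β : ℝ, klBetaMin ≤ β → β ≤ Real.exp (cc / U ^ 2) →
      ∀ (L M : ℕ) [NeZero L] [NeZero M], EngineV8.klEngL₃ β U ≤ L → EngineV8.klEngM₃ β U L ≤ M →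
      ∀ n : ℕ, 1 ≤ n → n ≤ nScales β + 1 →
        HistP klPredsV17F2 L M G P Q R β U μ 0 n → FrameOK R U (nScales β) μ (klFlowFrameU L M β U μ n) →
        ∀ J' : ℕ, J' ≤ n → (4 : ℝ) ^ n * U ≤ (16 : ℝ) ^ J' →
        ∀ ω : Fin (sectorCount J'),
          ∑ zz : TorusSite 1 (2 * M) × TorusSite 2 L,
              ‖∑ q : TorusSite 1 (2 * M) × TorusSite 2 L, (torusChar q.1 zz.1 * torusChar q.2 zz.2) •
                klAnisoFamily L M β μ (klFlowFrameU L M β U μ n) klE0 J' ω (⟨(q.1 0).val, ZMod.val_lt (q.1 0)⟩, q.2)‖ ≤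
            T * M * (L : ℝ) ^ 2 := by
  have ha : (-4 : ℝ) < -(6 / 5) := by norm_num
  have hab : (-(6 / 5) : ℝ) ≤ -(1 / 10) := by norm_num
  have hb : (-(1 / 10) : ℝ) < 0 := by norm_num
  -- the window band bounds and the absolute frame-size threshold (p4's keying)
  set B : BandBounds (-(6 / 5)) (-(1 / 10)) := bandBounds ha hab hb with hBdef
  set κ₀ : ℝ := min (min (B.Dtmin / 4) (B.rhomin / 4)) (1 / 40) with hκ₀
  have hDt := B.Dtmin_pos
  have hrh := B.rhomin_pos
  have hκ₀pos : 0 < κ₀ := by rw [hκ₀]; exact lt_min (lt_min (by positivity) (by positivity)) (by norm_num)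
  have hκ₀Dt : κ₀ ≤ B.Dtmin / 4 := (min_le_left _ _).trans (min_le_left _ _)
  have hκ₀rh : κ₀ ≤ B.rhomin / 4 := (min_le_left _ _).trans (min_le_right _ _)
  have hκ₀40 : κ₀ ≤ 1 / 40 := min_le_right _ _
  -- the cutoff constants (order three)
  have he : (0 : ℝ) < klE0 := by norm_num [klE0]
  obtain ⟨d₀, hd₀, hd₀1, hd₀2, hd₀3⟩ := exists_abs_derivs3_bgmCutoffSq_le he
  obtain ⟨B₀, hB₀0, hB₀⟩ := exists_norm_iteratedDeriv_sectorWeightCirc_polarAngle_line_le 3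
  have hd : (0 : ℝ) < d₀ + 1 := by linarith
  have hd1 : ∀ u, |deriv (bgmCutoffSq klE0) u| ≤ d₀ + 1 := fun u => (hd₀1 u).trans (by linarith)
  have hd2 : ∀ u, |iteratedDeriv 2 (bgmCutoffSq klE0) u| ≤ d₀ + 1 := fun u => (hd₀2 u).trans (by linarith)
  have hd3 : ∀ u, |iteratedDeriv 3 (bgmCutoffSq klE0) u| ≤ d₀ + 1 := fun u => (hd₀3 u).trans (by linarith)
  have hBa : (0 : ℝ) < B₀ + 1 := by linarith
  have hBo : ∀ (i : ℕ), i ≤ 3 → ∀ (n : ℕ) (ω : ℤ) (θ₀ : ℝ) (q w : Fin 2 → ℝ) (t : ℝ) {r₀ : ℝ}, 0 < r₀ →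
      r₀ ≤ ‖momToComplex (q + t • w)‖ → |sectorRelAngle θ₀ (q + t • w)| < π →
      ‖iteratedDeriv i (fun t : ℝ => sectorWeightCirc n ω (polarAngle (q + t • w))) t‖ ≤
        (3 : ℕ).factorial * (B₀ + 1) * ((1 + (sectorWidth n)⁻¹ * (3 : ℕ).factorial) * ‖momToComplex w‖ / r₀) ^ i := by
    intro i hi n ω θ₀ q w t r₀ hr₀ hr hθ
    refine (hB₀ i hi n ω θ₀ q w t hr₀ hr hθ).trans ?_
    have hX : 0 ≤ ((1 + (sectorWidth n)⁻¹ * (3 : ℕ).factorial) * ‖momToComplex w‖ / r₀) ^ i := by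
      have := sectorWidth_pos n; positivity
    have h2 : (0 : ℝ) ≤ (3 : ℕ).factorial := Nat.cast_nonneg _
    nlinarith [mul_nonneg h2 hX]
  -- the absolute constants
  set A : ℝ := κ₀ / 4 with hAdef
  have hA0 : 0 < A := by rw [hAdef]; positivity
  have hDtA : 0 < B.Dtmin - 2 * A := by rw [hAdef]; linarith
  have hrhA : 0 < 2 * B.rhomin - 4 * A := by rw [hAdef]; linarith
  have hsm := B.smax_pos
  have hπ := Real.pi_pos
  obtain ⟨cT, hcT⟩ : ∃ cT : ℝ, cT = 8 * ((d₀ + 1) * klE0 ^ 6) + 12 * ((d₀ + 1) * klE0 ^ 4) := ⟨_, rfl⟩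
  obtain ⟨κt, hκt⟩ : ∃ κt : ℝ, κt = max 1 cT := ⟨_, rfl⟩
  obtain ⟨ρb, hρb⟩ : ∃ ρb : ℝ, ρb = (klE0 + 3 * π / 2 * B.smax * B.Dtmin) / (B.Dtmin - 2 * A) := ⟨_, rfl⟩
  obtain ⟨G₁, hG₁⟩ : ∃ G₁ : ℝ, G₁ = 4 + 2 * A := ⟨_, rfl⟩
  obtain ⟨K₂, hK₂⟩ : ∃ K₂ : ℝ, K₂ = 4 + 4 * A := ⟨_, rfl⟩
  obtain ⟨Y₃, hY₃⟩ : ∃ Y₃ : ℝ, Y₃ = G₁ + 3 / 2 * K₂ * ρb + 9 / 2 * K₂ := ⟨_, rfl⟩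
  obtain ⟨κ₂, hκ₂⟩ : ∃ κ₂ : ℝ, κ₂ = (4 * ((d₀ + 1) * klE0 ^ 4) + 2 * ((d₀ + 1) * klE0 ^ 2)) * Y₃ ^ 2 +
      9 / 2 * ((d₀ + 1) * klE0 ^ 2) * K₂ * klE0 + 216 * ((d₀ + 1) * klE0 ^ 2) * (B₀ + 1) * Y₃ * klE0 + 486 * (B₀ + 1) * klE0 ^ 2 := ⟨_, rfl⟩
  obtain ⟨κ₃, hκ₃⟩ : ∃ κ₃ : ℝ, κ₃ = (8 * ((d₀ + 1) * klE0 ^ 6) + 12 * ((d₀ + 1) * klE0 ^ 4)) * G₁ ^ 3 +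
      (12 * ((d₀ + 1) * klE0 ^ 4) + 6 * ((d₀ + 1) * klE0 ^ 2)) * G₁ * K₂ * klE0 + 2 * ((d₀ + 1) * klE0 ^ 2) * (4 * klE0 ^ 2 + 8 * (1 / 3072)) +
      108 * (B₀ + 1) * ((4 * ((d₀ + 1) * klE0 ^ 4) + 2 * ((d₀ + 1) * klE0 ^ 2)) * G₁ ^ 2 * klE0 + 2 * ((d₀ + 1) * klE0 ^ 2) * K₂ * klE0 ^ 2) +
      1296 * ((d₀ + 1) * klE0 ^ 2) * G₁ * (B₀ + 1) * klE0 ^ 2 + 1296 * (B₀ + 1) * klE0 ^ 3 := ⟨_, rfl⟩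
  obtain ⟨κ, hκ⟩ : ∃ κ : ℝ, κ = max 1 (max κ₃ κ₂) := ⟨_, rfl⟩
  obtain ⟨Kc, hKc⟩ : ∃ Kc : ℝ, Kc = κ ^ 2 := ⟨_, rfl⟩
  obtain ⟨κX, hκX⟩ : ∃ κX : ℝ, κX = 4 * (3 * Real.sqrt 2 * π * Real.sqrt Kc + 2 * klE0) ^ 2 / klE0 +
      96 / (π * klE0 ^ 2) * ((π * Real.sqrt Kc / 2) * (π * Real.sqrt Kc / 2 + klE0) ^ 2) := ⟨_, rfl⟩
  obtain ⟨cN1, hcN1⟩ : ∃ cN1 : ℝ, cN1 = Real.sqrt 2 * (klE0 + (4 + 4 * A) * ρb ^ 2) / ((2 * B.rhomin - 4 * A) * π) + 2 := ⟨_, rfl⟩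
  obtain ⟨cN2, hcN2⟩ : ∃ cN2 : ℝ, cN2 = 2 * Real.sqrt 2 * ρb / π + 2 := ⟨_, rfl⟩
  have hκt1 : 1 ≤ κt := by rw [hκt]; exact le_max_left _ _
  have hκt0 : 0 < κt := lt_of_lt_of_le one_pos hκt1
  have hsqt : Real.sqrt (κt ^ 2) = κt := Real.sqrt_sq hκt0.le
  have hκ1 : 1 ≤ κ := by rw [hκ]; exact le_max_left _ _
  have hκp : 0 < κ := lt_of_lt_of_le one_pos hκ1
  have hsqK : Real.sqrt Kc = κ := by rw [hKc]; exact Real.sqrt_sq hκp.le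
  have hρb0 : 0 ≤ ρb := by rw [hρb]; positivity
  have hκX0 : 0 < κX := by rw [hκX]; positivity
  have hcN10 : 0 < cN1 := by rw [hcN1]; positivity
  have hcN20 : 0 < cN2 := by rw [hcN2]; positivity
  set T : ℝ := Real.sqrt (524288 * (π * Real.sqrt (κt ^ 2) + 1) * ((1 + 12 * Real.sqrt 2) ^ 2 / 4 + 1 / 16) * κX *
    (240 / π * (cN1 * cN2)) / klE0) with hTdef
  have hT0 : 0 < T := Real.sqrt_pos.2 (by rw [hsqt]; positivity)
  refine ⟨T, hT0, ?_⟩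
  intro G P R Q cc hR2 hcc hcc6 μ hμ U hU hUle β hβmin hβc L M _ _ hL3 hM3 n hn1 hnN hhist hfr J' hJ'n hwin ω
  have hRj : ∀ j, 0 ≤ R.Gfr j := EngineV8.gfr_nonneg_of_wf2 hR2
  have hβ0 : 0 < β := pos_of_klBetaMin_le hβmin
  have hcle : cc ≤ κ₀ / (12 * (R.Gfr 2 + 1)) :=
    (hcc6.trans (EngineV8.klEngC₃6_le_klEngC₃3 P R)).trans (EngineV8.klEngC₃3_le_symbolC₃ ha hab hb P hRj)
  have hU3 : U ≤ min 1 (κ₀ / (24 * (R.Gfr 0 + R.Gfr 1 + 1))) :=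
    (hUle.trans (min_le_left _ _)).trans (EngineV8.klEngU₀3_le_symbolU₀ ha hab hb P hRj cc)
  have hU1 : U ≤ 1 := hU3.trans (min_le_left _ _)
  have hUG : U ≤ 1 / (R.Gfr 3 + 1) := hUle.trans (min_le_right _ _)
  have hLβ : β ^ 2 ≤ (L : ℝ) := EngineV8.sq_le_of_klEngL₃_le hL3
  have hMβ : β ≤ (M : ℝ) := EngineV8.le_of_klEngM₃_le hβmin hL3 hM3
  set K : TrigPolyC4v := klFlowFrameU L M β U μ n with hKdef
  -- the frame's `C²` size is `≤ A = κ₀/4`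
  have hlog : 1 ≤ Real.log 4 := by
    have h4 : Real.exp 1 ≤ 4 := by have := Real.exp_one_lt_d9; norm_num at this; linarith
    calc (1 : ℝ) = Real.log (Real.exp 1) := (Real.log_exp 1).symm
      _ ≤ Real.log 4 := Real.log_le_log (Real.exp_pos 1) h4
  have hAK : ∀ p : Momentum, ∀ j ≤ 2, ‖iteratedFDeriv ℝ j (frameShift K) p‖ ≤ A := by
    intro p j hj
    refine (norm_iteratedFDeriv_frameShift_le_of_frameOK_regime hRj hcc.le hβmin hβc hfr p hj).trans ?_
    have h0 := hRj 0; have h1 := hRj 1; have h2 := hRj 2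
    have hUk : U ≤ κ₀ / (24 * (R.Gfr 0 + R.Gfr 1 + 1)) := hU3.trans (min_le_right _ _)
    rw [abs_of_pos hU]
    have hU2 : U ^ 2 ≤ U := by nlinarith only [hU, hU1]
    have hA1 : 2 * R.Gfr 0 * U + 2 * R.Gfr 1 * U ^ 2 ≤ 2 * (R.Gfr 0 + R.Gfr 1 + 1) * U := by
      have := mul_le_mul_of_nonneg_left hU2 h1
      linarith only [this, hU.le]
    have hB1 : 2 * (R.Gfr 0 + R.Gfr 1 + 1) * U ≤ κ₀ / 12 := by
      have hpos : 0 < 24 * (R.Gfr 0 + R.Gfr 1 + 1) := by positivity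
      have := (le_div_iff₀ hpos).mp hUk
      linarith only [this]
    have hC1 : R.Gfr 2 * (cc / Real.log 4) ≤ R.Gfr 2 * cc := mul_le_mul_of_nonneg_left (div_le_self hcc.le hlog) h2
    have hD1 : R.Gfr 2 * cc ≤ κ₀ / 12 := by
      have hpos : 0 < 12 * (R.Gfr 2 + 1) := by positivity
      have := (le_div_iff₀ hpos).mp hcle
      linarith only [this, hcc.le]
    rw [hAdef]; linarith only [hA1, hB1, hC1, hD1, hκ₀pos]
  -- the order-three frame datum of the FLOW frame from the history's (I-F jets), read at level `J′`
  obtain ⟨N, rfl⟩ : ∃ N, n = N + 1 := ⟨n - 1, by omega⟩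
  have hh := (histP_klPredsV17F2_iff L M G P Q R β U μ 0 (N + 1)).1 hhist
  have hJ : ∀ m ≤ N, FlowPieceJetsAt L M β U μ R m := fun m hm => (hh m (Nat.lt_succ_of_le hm)).2.1.2.1
  have hGeo : FlowGeometryAt L M β U μ N := (hh N (Nat.lt_succ_self N)).2.1.2.2
  have hK1 : FrameOK R U N μ K := frameOK_klFlowFrameU_succ hJ hGeo
  have hA3 : ∀ p : Momentum, ‖iteratedFDeriv ℝ 3 (frameShift K) p‖ ≤ R.Gfr 3 * U ^ 2 * ((4 : ℝ) ^ (N + 1) / 3) :=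
    (frameShift_high_sizes_of_frameOK hRj hK1).1
  have ha3 : R.Gfr 3 * U ^ 2 * ((4 : ℝ) ^ (N + 1) / 3) * klScale klE0 J' ^ 2 ≤ 1 / 3072 := by
    have hG3 := hRj 3
    have hGU : R.Gfr 3 * U ≤ 1 :=
      calc R.Gfr 3 * U ≤ R.Gfr 3 * (1 / (R.Gfr 3 + 1)) := mul_le_mul_of_nonneg_left hUG hG3
        _ = R.Gfr 3 / (R.Gfr 3 + 1) := by ring
        _ ≤ 1 := by rw [div_le_one (by positivity)]; linarith only [hG3]
    have h16 : (0 : ℝ) < (16 : ℝ) ^ J' := by positivity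
    have hkey : R.Gfr 3 * U ^ 2 * (4 : ℝ) ^ (N + 1) ≤ (16 : ℝ) ^ J' :=
      calc R.Gfr 3 * U ^ 2 * (4 : ℝ) ^ (N + 1) = (R.Gfr 3 * U) * ((4 : ℝ) ^ (N + 1) * U) := by ring
        _ ≤ 1 * (16 : ℝ) ^ J' := mul_le_mul hGU hwin (by positivity) zero_le_one
        _ = (16 : ℝ) ^ J' := one_mul _
    have hΛ : klScale klE0 J' ^ 2 = 1 / (1024 * (16 : ℝ) ^ J') := by
      rw [klScale, klE0, show (16 : ℝ) ^ J' = ((4 : ℝ) ^ J') ^ 2 by rw [← pow_mul, show (16 : ℝ) = 4 ^ 2 by norm_num, ← pow_mul, mul_comm]]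
      have h4 : (0 : ℝ) < (4 : ℝ) ^ J' := by positivity
      field_simp
      norm_num
    rw [hΛ]
    rw [show R.Gfr 3 * U ^ 2 * ((4 : ℝ) ^ (N + 1) / 3) * (1 / (1024 * (16 : ℝ) ^ J')) =
      (R.Gfr 3 * U ^ 2 * (4 : ℝ) ^ (N + 1)) / (16 : ℝ) ^ J' * (1 / 3072) by field_simp; ring]
    have : (R.Gfr 3 * U ^ 2 * (4 : ℝ) ^ (N + 1)) / (16 : ℝ) ^ J' ≤ 1 := by rw [div_le_one h16]; exact hkey
    linarith
  -- the window margins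
  have hμ' := hμ
  simp only [klWindowC, Set.mem_Icc] at hμ'
  have e1 : (-1.05 : ℝ) = -(21 / 20) := by norm_num
  have e2 : (-0.15 : ℝ) = -(3 / 20) := by norm_num
  have hμlo : -(21 / 20 : ℝ) ≤ μ := by rw [← e1]; exact hμ'.1
  have hμhi : μ ≤ -(3 / 20 : ℝ) := by rw [← e2]; exact hμ'.2
  have he0 : klE0 = 1 / 32 := rfl
  have hgap : klE0 + A + (1 / 10 : ℝ) ^ 2 < -μ := by rw [he0, hAdef]; linarith only [hμhi, hκ₀40]
  have h3 : klE0 + A - μ ≤ 3 := by rw [he0, hAdef]; linarith only [hμlo, hκ₀40]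
  have hlo : (-(6 / 5) : ℝ) ≤ μ - A - klE0 := by rw [he0, hAdef]; linarith only [hμlo, hκ₀40]
  have hhi : μ + A + klE0 ≤ -(1 / 10) := by rw [he0, hAdef]; linarith only [hμhi, hκ₀40]
  have hADt : 2 * A < B.Dtmin := by rw [hAdef]; linarith
  have hρA : 4 * A < 2 * B.rhomin := by rw [hAdef]; linarith
  -- the scale thresholds at level `J′ ≤ n ≤ n_β + 1`
  obtain ⟨hM, hMβ', hLz, hL16, hΛβ⟩ := regime_scale_thresholds₃ hβmin hLβ hMβ (hJ'n.trans hnN)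
  -- the weighted single-multiplier bound on the admissible frame `K_n` at level `J′`
  have hmain := charSumWt_klAniso_le_uniform (L := L) (M := M) (μ := μ) (K := K) B hAK hADt hA3 he (by norm_num : (0 : ℝ) < 1 / 10)
    (by norm_num : (1 / 10 : ℝ) ≤ 1) hgap h3 hlo hhi hβ0 hρA ω hd hd1 hd2 hd3
    (Z := fun p => gnCutoff ((π + 1 / 10) ^ 2 / π ^ 2) ((π + 1 / 10) ^ 2) (p 0 ^ 2) *
      gnCutoff ((π + 1 / 10) ^ 2 / π ^ 2) ((π + 1 / 10) ^ 2) (p 1 ^ 2) *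
      (radialCutoffC (1 / 2) (momToComplex p) * sectorWeightCirc J' ((ω : ℕ) : ℤ) (polarAngle p)))
    (fun p => rfl)
    (Φ := fun kp => ((bgmCutoffSq klE0 ((16 : ℝ) ^ J' * (kp.1 ^ 2 + frameLevel μ K (WithLp.toLp 2 kp.2) ^ 2)) *
      (gnCutoff ((π + 1 / 10) ^ 2 / π ^ 2) ((π + 1 / 10) ^ 2) (kp.2 0 ^ 2) *
        gnCutoff ((π + 1 / 10) ^ 2 / π ^ 2) ((π + 1 / 10) ^ 2) (kp.2 1 ^ 2) *
        (radialCutoffC (1 / 2) (momToComplex kp.2) * sectorWeightCirc J' ((ω : ℕ) : ℤ) (polarAngle kp.2))) : ℝ) : ℂ))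
    (fun k₀ p => rfl)
    (Gs := fun q => klAnisoFamily L M β μ K klE0 J' ω (⟨(q.1 0).val, ZMod.val_lt (q.1 0)⟩, q.2)) (fun q => rfl)
    hBa hBo hcT hκt hρb hG₁ hK₂ hY₃ hκ₂ hκ₃ hκ hKc hκX hcN1 hcN2 ha3 hM hMβ' hLz hL16 hΛβ
  rw [hsqt, hsqK] at hmain
  have hL0 : (0 : ℝ) < L := Nat.cast_pos.2 (Nat.pos_of_ne_zero (NeZero.ne L))
  have hM0 : (0 : ℝ) < M := Nat.cast_pos.2 (Nat.pos_of_ne_zero (NeZero.ne M))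
  have hΛ0 : 0 ≤ klScale klE0 J' := by rw [klScale, klE0]; positivity
  -- drop the weight (`≥ 1`)
  refine le_trans (sum_le_sum fun zz _ => ?_) (hmain.trans (le_of_eq ?_))
  · refine le_mul_of_one_le_left (norm_nonneg _) ?_
    have h1 : 0 ≤ 2 * klScale klE0 J' * β / (((2 * M : ℕ) : ℝ) * π * κt) * |(((zz.1 0).valMinAbs : ℤ) : ℝ)| := by positivity
    have h2 : 0 ≤ 2 * klScale klE0 J' / (π * κ) * |(((zz.2 0).valMinAbs : ℤ) : ℝ)| := by positivity
    have h3' : 0 ≤ 2 * klScale klE0 J' / (π * κ) * |(((zz.2 1).valMinAbs : ℤ) : ℝ)| := by positivity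
    linarith
  · rw [hTdef, hsqt]

/-! ## §2 The plain overlap rows of `E(klAnisoFamily J′)·S(trivialMultiplier)` at the flow frame -/

/-- **`hrow′ ≤ T·M/β`, `hcol′ ≤ sectorCount J′ · T·M/β` for `E(klAnisoFamily … K_n klE0 J′)·S(trivialMultiplier)`** under p3's binders, `J′ ≤ n`,
window `4ⁿ·U ≤ 16^{J′}` (p4's `rowSum_/colSum_overlapKernel_eq` with the constant fat symbol). [cite: BenfattoGiulianiMastropietro2006, §2.7 (2.71a)] -/
theorem overlapRows_klAniso_trivial_klEng_flow :
    ∃ T : ℝ, 0 < T ∧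
      ∀ (G : GeoConsts) (P : SplitConsts) (R : RenConsts) (Q : EngConsts) (cc : ℝ), R.WF2 → 0 < cc → cc ≤ EngineV8.klEngC₃6 P R →
      ∀ μ ∈ klWindowC, ∀ U : ℝ, 0 < U → U ≤ min (EngineV8.klEngU₀3 P R cc) (1 / (R.Gfr 3 + 1)) →
      ∀ β : ℝ, klBetaMin ≤ β → β ≤ Real.exp (cc / U ^ 2) →
      ∀ (L M : ℕ) [NeZero L] [NeZero M], EngineV8.klEngL₃ β U ≤ L → EngineV8.klEngM₃ β U L ≤ M →
      ∀ n : ℕ, 1 ≤ n → n ≤ nScales β + 1 →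
        HistP klPredsV17F2 L M G P Q R β U μ 0 n → FrameOK R U (nScales β) μ (klFlowFrameU L M β U μ n) →
        ∀ J' : ℕ, J' ≤ n → (4 : ℝ) ^ n * U ≤ (16 : ℝ) ^ J' →
        (∀ X'' : SpaceTimeIdx L M × SectorLeg (sectorCount J'), ∑ X' : SpaceTimeIdx L M × SectorLeg 1,
          ‖(sectorAnalysisMatrix L M β (klAnisoFamily L M β μ (klFlowFrameU L M β U μ n) klE0 J') *
            sectorSubMatrix L M β (trivialMultiplier L M)) X'' X'‖ ≤ T * M / β) ∧
        (∀ X' : SpaceTimeIdx L M × SectorLeg 1, ∑ X'' : SpaceTimeIdx L M × SectorLeg (sectorCount J'),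
          ‖(sectorAnalysisMatrix L M β (klAnisoFamily L M β μ (klFlowFrameU L M β U μ n) klE0 J') *
            sectorSubMatrix L M β (trivialMultiplier L M)) X'' X'‖ ≤ (sectorCount J' : ℝ) * T * M / β) := by
  obtain ⟨T, hT0, h⟩ := charSum_klAniso_single_klEng_flow
  refine ⟨T, hT0, ?_⟩
  intro G P R Q cc hR2 hcc hcc6 μ hμ U hU hUle β hβmin hβc L M _ _ hL3 hM3 n hn1 hnN hhist hfr J' hJ'n hwin
  have hβ0 : 0 < β := pos_of_klBetaMin_le hβmin
  have hL0 : (0 : ℝ) < L := Nat.cast_pos.2 (Nat.pos_of_ne_zero (NeZero.ne L))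
  have hS := h G P R Q cc hR2 hcc hcc6 μ hμ U hU hUle β hβmin hβc L M hL3 hM3 n hn1 hnN hhist hfr J' hJ'n hwin
  set K := klFlowFrameU L M β U μ n with hK
  -- per-label row and column sums
  have hlab : ∀ (ω : Fin (sectorCount J')) (σ c : Fin 2) (x'' x' : SpaceTimeIdx L M),
      (∑ y : SpaceTimeIdx L M, ‖(sectorAnalysisMatrix L M β (klAnisoFamily L M β μ K klE0 J') * sectorSubMatrix L M β (trivialMultiplier L M))
          (x'', ((ω, σ), c)) (y, (((0 : Fin 1), σ), c))‖ ≤ T * M / β) ∧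
      (∑ y : SpaceTimeIdx L M, ‖(sectorAnalysisMatrix L M β (klAnisoFamily L M β μ K klE0 J') * sectorSubMatrix L M β (trivialMultiplier L M))
          (y, ((ω, σ), c)) (x', (((0 : Fin 1), σ), c))‖ ≤ T * M / β) := by
    intro ω σ c x'' x'
    have e : 1 / (β * (L : ℝ) ^ 2) * (T * M * (L : ℝ) ^ 2) = T * M / β := by field_simp
    constructor
    · rw [rowSum_overlapKernel_eq hβ0]
      simp only [trivialMultiplier, mul_one]
      rw [← e]
      exact mul_le_mul_of_nonneg_left (hS ω) (by positivity)
    · rw [colSum_overlapKernel_eq hβ0]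
      simp only [trivialMultiplier, mul_one]
      rw [← e]
      exact mul_le_mul_of_nonneg_left (hS ω) (by positivity)
  refine ⟨fun X'' => ?_, fun X' => ?_⟩
  · obtain ⟨x'', ⟨⟨ω, σ⟩, c⟩⟩ := X''
    rw [Fintype.sum_prod_type]
    have hinner : ∀ x' : SpaceTimeIdx L M, ∑ ℓ' : SectorLeg 1,
        ‖(sectorAnalysisMatrix L M β (klAnisoFamily L M β μ K klE0 J') * sectorSubMatrix L M β (trivialMultiplier L M)) (x'', ((ω, σ), c)) (x', ℓ')‖ =
        ‖(sectorAnalysisMatrix L M β (klAnisoFamily L M β μ K klE0 J') * sectorSubMatrix L M β (trivialMultiplier L M))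
          (x'', ((ω, σ), c)) (x', (((0 : Fin 1), σ), c))‖ := by
      intro x'
      rw [Fintype.sum_prod_type, Fintype.sum_prod_type, Fin.sum_univ_one]
      exact sum_spin_charge_eq_single _ σ c fun σ' c' hne => by
        rw [sectorAnalysis_mul_sectorSub_apply_of_not β _ _ _ _ (fun h' : σ' = σ ∧ c' = c => hne h'), norm_zero]
    simp_rw [hinner]
    exact (hlab ω σ c x'' x'').1
  · obtain ⟨x', ⟨⟨ω', σ⟩, c⟩⟩ := X'
    obtain rfl : ω' = 0 := Subsingleton.elim _ _
    rw [Fintype.sum_prod_type]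
    have hinner : ∀ x'' : SpaceTimeIdx L M, ∑ ℓ'' : SectorLeg (sectorCount J'),
        ‖(sectorAnalysisMatrix L M β (klAnisoFamily L M β μ K klE0 J') * sectorSubMatrix L M β (trivialMultiplier L M)) (x'', ℓ'')
          (x', (((0 : Fin 1), σ), c))‖ =
        ∑ ω : Fin (sectorCount J'), ‖(sectorAnalysisMatrix L M β (klAnisoFamily L M β μ K klE0 J') * sectorSubMatrix L M β (trivialMultiplier L M))
          (x'', ((ω, σ), c)) (x', (((0 : Fin 1), σ), c))‖ := by
      intro x''
      rw [Fintype.sum_prod_type, Fintype.sum_prod_type]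
      refine sum_congr rfl fun ω _ => ?_
      exact sum_spin_charge_eq_single _ σ c fun σ'' c'' hne => by
        rw [sectorAnalysis_mul_sectorSub_apply_of_not β _ _ _ _ (fun h' : σ = σ'' ∧ c = c'' => hne ⟨h'.1.symm, h'.2.symm⟩), norm_zero]
    simp_rw [hinner]
    rw [sum_comm]
    calc ∑ ω : Fin (sectorCount J'), ∑ x'' : SpaceTimeIdx L M,
          ‖(sectorAnalysisMatrix L M β (klAnisoFamily L M β μ K klE0 J') * sectorSubMatrix L M β (trivialMultiplier L M))
            (x'', ((ω, σ), c)) (x', (((0 : Fin 1), σ), c))‖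
        ≤ ∑ _ω : Fin (sectorCount J'), T * M / β := sum_le_sum fun ω _ => (hlab ω σ c x' x').2
      _ = (sectorCount J' : ℝ) * T * M / β := by rw [sum_const, card_univ, Fintype.card_fin, nsmul_eq_mul]; ring

/-! ## §3 The supplier's small steps `n ≤ 4` (window discharged) and the point-augmented output family -/

/-- **«(RA-U)-SMALL-N-ROWS» CLOSED**: for `n ≤ 4` the window `4ⁿ·U ≤ 16^{J′}` is automatic (`U ≤ klEngU₀3 ≤ 1/960`), so under p3's binders, for every
`J′ ≤ n` and all point momenta `e : Fin q → _`: plain `hrow′ ≤ T·M/β`, `hcol′ ≤ sectorCount J′·T·M/β` for `E(klAnisoFamily J′)·S(1)`, and on the augmented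
output family `E(pointAugment (klAnisoFamily J′) e)·S(1)`: `hrow′ ≤ (T + 2)·M/β`, `hcol′ ≤ (sectorCount J′·T + 2q)·M/β`.
[cite: BenfattoGiulianiMastropietro2006, §2.7 (2.71a)] -/
theorem overlapRows_klAniso_trivial_klEng_small :
    ∃ T : ℝ, 0 < T ∧
      ∀ (G : GeoConsts) (P : SplitConsts) (R : RenConsts) (Q : EngConsts) (cc : ℝ), R.WF2 → 0 < cc → cc ≤ EngineV8.klEngC₃6 P R →
      ∀ μ ∈ klWindowC, ∀ U : ℝ, 0 < U → U ≤ min (EngineV8.klEngU₀3 P R cc) (1 / (R.Gfr 3 + 1)) →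
      ∀ β : ℝ, klBetaMin ≤ β → β ≤ Real.exp (cc / U ^ 2) →
      ∀ (L M : ℕ) [NeZero L] [NeZero M], EngineV8.klEngL₃ β U ≤ L → EngineV8.klEngM₃ β U L ≤ M →
      ∀ n : ℕ, 1 ≤ n → n ≤ 4 → n ≤ nScales β + 1 →
        HistP klPredsV17F2 L M G P Q R β U μ 0 n → FrameOK R U (nScales β) μ (klFlowFrameU L M β U μ n) →
        ∀ J' : ℕ, J' ≤ n → ∀ {q : ℕ} (e : Fin q → FreqMomentum L M),
        (∀ X'' : SpaceTimeIdx L M × SectorLeg (sectorCount J' + q), ∑ X' : SpaceTimeIdx L M × SectorLeg 1,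
          ‖(sectorAnalysisMatrix L M β (pointAugment (klAnisoFamily L M β μ (klFlowFrameU L M β U μ n) klE0 J') e) *
            sectorSubMatrix L M β (trivialMultiplier L M)) X'' X'‖ ≤ (T + 2) * M / β) ∧
        (∀ X' : SpaceTimeIdx L M × SectorLeg 1, ∑ X'' : SpaceTimeIdx L M × SectorLeg (sectorCount J' + q),
          ‖(sectorAnalysisMatrix L M β (pointAugment (klAnisoFamily L M β μ (klFlowFrameU L M β U μ n) klE0 J') e) *
            sectorSubMatrix L M β (trivialMultiplier L M)) X'' X'‖ ≤ ((sectorCount J' : ℝ) * T + 2 * q) * M / β) := by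
  obtain ⟨T, hT0, h⟩ := overlapRows_klAniso_trivial_klEng_flow
  refine ⟨T, hT0, ?_⟩
  intro G P R Q cc hR2 hcc hcc6 μ hμ U hU hUle β hβmin hβc L M _ _ hL3 hM3 n hn1 hn4 hnN hhist hfr J' hJ'n q e
  have ha : (-4 : ℝ) < -(6 / 5) := by norm_num
  have hab : (-(6 / 5) : ℝ) ≤ -(1 / 10) := by norm_num
  have hb : (-(1 / 10) : ℝ) < 0 := by norm_num
  have hRj : ∀ j, 0 ≤ R.Gfr j := EngineV8.gfr_nonneg_of_wf2 hR2
  have hβ0 : 0 < β := pos_of_klBetaMin_le hβmin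
  have hM0 : (0 : ℝ) ≤ M := Nat.cast_nonneg _
  -- the window: `U ≤ 1/960`, `4ⁿ ≤ 256`
  have hU3 : U ≤ min 1 (min (min ((bandBounds ha hab hb).Dtmin / 4) ((bandBounds ha hab hb).rhomin / 4)) (1 / 40) / (24 * (R.Gfr 0 + R.Gfr 1 + 1))) :=
    (hUle.trans (min_le_left _ _)).trans (EngineV8.klEngU₀3_le_symbolU₀ ha hab hb P hRj cc)
  have hU960 : U ≤ 1 / 960 := by
    refine (hU3.trans (min_le_right _ _)).trans ?_
    have hG : 1 ≤ R.Gfr 0 + R.Gfr 1 + 1 := by linarith [hRj 0, hRj 1]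
    have hκ : min (min ((bandBounds ha hab hb).Dtmin / 4) ((bandBounds ha hab hb).rhomin / 4)) (1 / 40) ≤ 1 / 40 := min_le_right _ _
    calc _ ≤ (1 / 40 : ℝ) / (24 * (R.Gfr 0 + R.Gfr 1 + 1)) := div_le_div_of_nonneg_right hκ (by positivity)
      _ ≤ (1 / 40 : ℝ) / (24 * 1) := div_le_div_of_nonneg_left (by norm_num) (by norm_num) (by linarith)
      _ = 1 / 960 := by norm_num
  have hwin : (4 : ℝ) ^ n * U ≤ (16 : ℝ) ^ J' :=
    calc (4 : ℝ) ^ n * U ≤ (4 : ℝ) ^ 4 * (1 / 960) := mul_le_mul (pow_le_pow_right₀ (by norm_num) hn4) hU960 hU.le (by positivity)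
      _ ≤ 1 := by norm_num
      _ ≤ (16 : ℝ) ^ J' := one_le_pow₀ (by norm_num)
  obtain ⟨hr, hc⟩ := h G P R Q cc hR2 hcc hcc6 μ hμ U hU hUle β hβmin hβc L M hL3 hM3 n hn1 hnN hhist hfr J' hJ'n hwin
  have hcr0 : 0 ≤ T * M / β := by positivity
  obtain ⟨h1, h2⟩ := overlapRows_pointAugment_klAniso_trivial (L := L) (M := M) hβ0 μ (klFlowFrameU L M β U μ n) J' e hcr0 hr hc
  have hε : (imagTimeWeight β M)⁻¹ = 2 * (M : ℝ) / β := by rw [imagTimeWeight, inv_div]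
  refine ⟨fun X'' => (h1 X'').trans (le_of_eq ?_), fun X' => (h2 X').trans (le_of_eq ?_)⟩
  · rw [hε]; ring
  · rw [hε]; ring

end Summit.HubbardSuperconductivity.HubbardSuperconductivity.Theorems.KLRegimeSplit

end
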